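import Mathlib
import Summits.Ventures.HodgeRepro.Tier4.Common.HeckeOnForms

/-!
# Tier4/Common/HeckeInvariance — a Hecke element of level `Γ′` carries the `1`-forms of `X_{Γ′}` to `1`-forms of `X_{Γ′}`

Blind re-derivation cell `pub-hodge-repro`, Tier 4 (README §9–§10), seat t4-typer-1 (gen 0).  Target tree path
`lean/Summits/Ventures/HodgeRepro/Tier4/Common/HeckeInvariance.lean`.  Imports `Tier4/Common/HeckeOnForms.lean`
(typer-1: `heckeSum`, `heckeField`, `pullField_comp`, `act_mul`, the unitary representatives).

WHAT IS PROVED.  The group facts of the target's `IsCongruenceSubgroup` (two-sided inverses inside `Γ′`) and of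
`IsCosetReps` (`unique`: two representatives in one right coset coincide; `exists_rep`: `r δ ∈ Γ′ r′` for some
`r′ ∈ R`), the germ-dependence `pullField_congr` of the pull-back, and **`heckeField_isAutForm1`**: for `h` of
level `Γ′` and a `1`-form `G` of `X_{Γ′}`, the Hecke translate `heckeField d h G` is a `1`-form of `X_{Γ′}`.
Proof: `(act δ)^*(Σ_r (act r)^* G) = Σ_r (act (r δ))^* G` (functoriality of the pull-back on the ball),
`r δ = γ_r · σ(r)` with `γ_r ∈ Γ′`, `σ(r) ∈ R`, so each term is `(act σ(r))^* ((act γ_r)^* G) = (act σ(r))^* G` by the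
`Γ′`-invariance of `G`, and `σ` is a bijection of the finite set `R` (injective by the uniqueness clause of
`IsCosetReps`), so the sum is unchanged.

Nothing here says anything about the status of the Hodge conjecture for CM abelian varieties, which is NOT proved
(HC_CM is NOT proved by anyone in this repository).
-/

set_option autoImplicit false

noncomputable section

open Matrix MeasureTheory NumberField
open scoped ComplexConjugate ComplexOrder

namespace Summit.Ventures.HodgeRepro.Tier4

/-! ## Group facts about congruence subgroups and coset representatives -/

section Groups

variable {E : Type} [Field E] {c : E ≃+* E} {H : Matrix (Fin 3) (Fin 3) E} {Γ : Set (Matrix (Fin 3) (Fin 3) E)}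

/-- `1 ∈ Γ`. -/
theorem IsCongruenceSubgroup.one_mem (hΓ : IsCongruenceSubgroup c H Γ) : (1 : Matrix (Fin 3) (Fin 3) E) ∈ Γ := hΓ.1

/-- `Γ` is closed under multiplication. -/
theorem IsCongruenceSubgroup.mul_mem (hΓ : IsCongruenceSubgroup c H Γ) {g k : Matrix (Fin 3) (Fin 3) E}
    (hg : g ∈ Γ) (hk : k ∈ Γ) : g * k ∈ Γ := hΓ.2.1 g hg k hk

/-- Every element of `Γ` has a two-sided inverse in `Γ`. -/
theorem IsCongruenceSubgroup.exists_inv (hΓ : IsCongruenceSubgroup c H Γ) {g : Matrix (Fin 3) (Fin 3) E}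
    (hg : g ∈ Γ) : ∃ k ∈ Γ, g * k = 1 ∧ k * g = 1 := by
  obtain ⟨k, hk, hgk⟩ := hΓ.2.2.1 g hg
  exact ⟨k, hk, hgk, mul_eq_one_comm.1 hgk⟩

/-- Every element of `Γ` is `H`-unitary. -/
theorem IsCongruenceSubgroup.isUnitaryOf (hΓ : IsCongruenceSubgroup c H Γ) {g : Matrix (Fin 3) (Fin 3) E}
    (hg : g ∈ Γ) : IsUnitaryOf c H g := (hΓ.2.2.2.1 hg).1

/-- **Uniqueness of representatives**: two elements of `R` in the same right coset `Γ r` coincide. -/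
theorem IsCosetReps.unique (hΓ : IsCongruenceSubgroup c H Γ) {g : Matrix (Fin 3) (Fin 3) E}
    {R : Finset (Matrix (Fin 3) (Fin 3) E)} (hR : IsCosetReps Γ g R) {r₁ r₂ : Matrix (Fin 3) (Fin 3) E}
    (h₁ : r₁ ∈ R) (h₂ : r₂ ∈ R) {γ : Matrix (Fin 3) (Fin 3) E} (hγ : γ ∈ Γ) (h : r₁ = γ * r₂) : r₁ = r₂ := by
  obtain ⟨a, ha, b, hb, hr₂⟩ := hR.1 r₂ h₂
  obtain ⟨γ', hγ', _, hγ'γ⟩ := hΓ.exists_inv hγ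
  have hu := hR.2 a ha b hb
  have p₂ : r₂ ∈ R ∧ ∃ γ ∈ Γ, a * g * b = γ * r₂ := ⟨h₂, 1, hΓ.one_mem, by rw [hr₂, Matrix.one_mul]⟩
  have p₁ : r₁ ∈ R ∧ ∃ γ ∈ Γ, a * g * b = γ * r₁ :=
    ⟨h₁, γ', hγ', by rw [← hr₂, h, ← Matrix.mul_assoc, hγ'γ, Matrix.one_mul]⟩
  exact hu.unique p₁ p₂

/-- **Translating a representative**: for `r ∈ R` and `δ ∈ Γ`, `r δ ∈ Γ r′` for some `r′ ∈ R`. -/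
theorem IsCosetReps.exists_rep (hΓ : IsCongruenceSubgroup c H Γ) {g : Matrix (Fin 3) (Fin 3) E}
    {R : Finset (Matrix (Fin 3) (Fin 3) E)} (hR : IsCosetReps Γ g R) {r : Matrix (Fin 3) (Fin 3) E} (hr : r ∈ R)
    {δ : Matrix (Fin 3) (Fin 3) E} (hδ : δ ∈ Γ) : ∃ r' ∈ R, ∃ γ ∈ Γ, r * δ = γ * r' := by
  obtain ⟨a, ha, b, hb, rfl⟩ := hR.1 r hr
  obtain ⟨r', ⟨hr'R, γ, hγ, hγr'⟩, _⟩ := hR.2 a ha (b * δ) (hΓ.mul_mem hb hδ)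
  exact ⟨r', hr'R, γ, hγ, by rw [Matrix.mul_assoc, hγr']⟩

end Groups

/-! ## The pull-back depends on the germ of the map -/

/-- Two maps that agree near `z` have the same pull-back at `z`. -/
theorem pullField_congr {φ ψ : (Fin 2 → ℂ) → (Fin 2 → ℂ)} {z : Fin 2 → ℂ} (h : φ =ᶠ[nhds z] ψ)
    (G : (Fin 2 → ℂ) → (Fin 2 → ℂ)) : pullField φ G z = pullField ψ G z := by
  have hz : φ z = ψ z := h.eq_of_nhds
  have hJ : jacMat φ z = jacMat ψ z := by
    ext j k
    simp only [jacMat, pd]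
    have hj : (fun w => φ w j) =ᶠ[nhds z] fun w => ψ w j := h.mono fun w hw => by simp [hw]
    rw [hj.fderiv_eq]
  simp only [pullField, hz, hJ]

namespace TargetData

variable {F E : Type} [Field F] [NumberField F] [IsGalois ℚ F] [IsCMField F]
  [Field E] [NumberField E] [IsGalois ℚ E] [IsCMField E] (d : TargetData F E)

/-- On the ball `act (γ δ)` and `act γ ∘ act δ` agree near every point (`δ` unitary). -/
theorem act_mul_eventuallyEq {γ δ : Matrix (Fin 3) (Fin 3) E} (hδ : IsUnitaryOf (conjE E) d.H δ)
    {z : Fin 2 → ℂ} (hz : z ∈ ball) : d.act (γ * δ) =ᶠ[nhds z] (d.act γ ∘ d.act δ) := by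
  filter_upwards [isOpen_ball.mem_nhds hz] with w hw
  exact d.act_mul hδ hw

/-- **Functoriality on the ball**: `(act δ)^*((act γ)^* G) = (act (γ δ))^* G` at a point of the ball, `γ, δ` unitary. -/
theorem pullField_act_act {γ δ : Matrix (Fin 3) (Fin 3) E} (hγ : IsUnitaryOf (conjE E) d.H γ)
    (hδ : IsUnitaryOf (conjE E) d.H δ) (G : (Fin 2 → ℂ) → (Fin 2 → ℂ)) {z : Fin 2 → ℂ} (hz : z ∈ ball) :
    pullField (d.act δ) (pullField (d.act γ) G) z = pullField (d.act (γ * δ)) G z := by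
  rw [pullField_comp G (d.differentiableAt_act_of_unitary hγ (d.act_mem_ball_of_unitary hδ hz))
    (d.differentiableAt_act_of_unitary hδ hz), pullField_congr (d.act_mul_eventuallyEq hδ hz)]

/-- The pull-back along the action is linear: it commutes with the Hecke sum of one term. -/
theorem pullField_act_finset_sum {δ : Matrix (Fin 3) (Fin 3) E} (R : Finset (Matrix (Fin 3) (Fin 3) E))
    (G : (Fin 2 → ℂ) → (Fin 2 → ℂ)) (z : Fin 2 → ℂ) :
    pullField (d.act δ) (fun w => ∑ r ∈ R, pullField (d.act r) G w) z =
      ∑ r ∈ R, pullField (d.act δ) (pullField (d.act r) G) z := by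
  simp only [pullField, Matrix.mulVec_sum]

/-- **The one-term case of the invariance**: for `R` a complete system of representatives of `Γ′ g Γ′`
(`g` unitary), `G` a `1`-form of `X_{Γ′}` and `δ ∈ Γ′`, the sum `Σ_{r ∈ R} (act r)^* G` is `δ`-invariant on the ball. -/
theorem pullField_act_sum_reps {Γ' : Set (Matrix (Fin 3) (Fin 3) E)} (hΓ' : IsCongruenceSubgroup (conjE E) d.H Γ')
    {g : Matrix (Fin 3) (Fin 3) E} (hg : IsUnitaryOf (conjE E) d.H g) {R : Finset (Matrix (Fin 3) (Fin 3) E)}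
    (hR : IsCosetReps Γ' g R) {G : (Fin 2 → ℂ) → (Fin 2 → ℂ)} (hG : d.IsAutForm1 Γ' G)
    {δ : Matrix (Fin 3) (Fin 3) E} (hδ : δ ∈ Γ') {z : Fin 2 → ℂ} (hz : z ∈ ball) :
    ∑ r ∈ R, pullField (d.act δ) (pullField (d.act r) G) z = ∑ r ∈ R, pullField (d.act r) G z := by
  -- every representative is unitary
  have hunit : ∀ r ∈ R, IsUnitaryOf (conjE E) d.H r := by
    intro r hr
    obtain ⟨a, ha, b, hb, rfl⟩ := hR.1 r hr
    exact ((hΓ'.isUnitaryOf ha).mul hg).mul (hΓ'.isUnitaryOf hb)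
  have hδu : IsUnitaryOf (conjE E) d.H δ := hΓ'.isUnitaryOf hδ
  -- the permutation `σ` of `R`: `r δ = γ_r σ(r)`
  have hex : ∀ r ∈ R, ∃ r' ∈ R, ∃ γ ∈ Γ', r * δ = γ * r' := fun r hr => hR.exists_rep hΓ' hr hδ
  choose! σ hσR γf hγf hσ using hex
  -- each term: `(act δ)^*((act r)^* G) = (act (r δ))^* G = (act (γ_r σ r))^* G = (act (σ r))^*((act γ_r)^* G) = (act (σ r))^* G`
  have hterm : ∀ r ∈ R, pullField (d.act δ) (pullField (d.act r) G) z = pullField (d.act (σ r)) G z := by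
    intro r hr
    rw [d.pullField_act_act (hunit r hr) hδu G hz, hσ r hr,
      ← d.pullField_act_act (hΓ'.isUnitaryOf (hγf r hr)) (hunit _ (hσR r hr)) G hz]
    have hinv := hG.2 _ (hγf r hr) _ (d.act_mem_ball_of_unitary (hunit _ (hσR r hr)) hz)
    simp only [pullField] at hinv ⊢
    rw [hinv]
  rw [Finset.sum_congr rfl hterm]
  -- `σ` is injective on `R`, hence a bijection of `R`
  have hinj : ∀ r₁ ∈ R, ∀ r₂ ∈ R, σ r₁ = σ r₂ → r₁ = r₂ := by
    intro r₁ h₁ r₂ h₂ heq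
    obtain ⟨γ₂', hγ₂', _, hγ₂'γ⟩ := hΓ'.exists_inv (hγf r₂ h₂)
    obtain ⟨δ', _, hδδ', _⟩ := hΓ'.exists_inv hδ
    -- `r₁ δ = γ₁ σ r₁ = γ₁ γ₂'⁻¹ r₂ δ`, cancel `δ`
    have h1 : r₁ * δ = γf r₁ * σ r₁ := hσ r₁ h₁
    have h2 : r₂ * δ = γf r₂ * σ r₂ := hσ r₂ h₂
    have h3 : σ r₂ = γ₂' * (r₂ * δ) := by rw [h2, ← Matrix.mul_assoc, hγ₂'γ, Matrix.one_mul]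
    have h4 : r₁ * δ = (γf r₁ * γ₂') * (r₂ * δ) := by rw [h1, heq, h3, Matrix.mul_assoc]
    have h5 : r₁ = (γf r₁ * γ₂') * r₂ := by
      have := congrArg (fun m => m * δ') h4
      simp only [Matrix.mul_assoc, hδδ', Matrix.mul_one] at this
      simpa [Matrix.mul_assoc] using this
    exact hR.unique hΓ' h₁ h₂ (hΓ'.mul_mem (hγf r₁ h₁) hγ₂') h5
  have hsurj : ∀ r' ∈ R, ∃ r ∈ R, σ r = r' := by
    intro r' hr'
    obtain ⟨r, hr, hrr'⟩ := Finset.surj_on_of_inj_on_of_card_le (fun r _ => σ r) (fun r hr => hσR r hr)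
      (fun r₁ r₂ h₁ h₂ h => hinj r₁ h₁ r₂ h₂ h) le_rfl r' hr'
    exact ⟨r, hr, hrr'.symm⟩
  exact Finset.sum_nbij σ (fun r hr => hσR r hr) (fun r₁ h₁ r₂ h₂ h => hinj r₁ h₁ r₂ h₂ h)
    (fun r' hr' => hsurj r' hr') (fun _ _ => rfl)

/-- The Hecke sum of a term and the rest, as functions. -/
theorem heckeSum_cons_fun (t : ℤ × Finset (Matrix (Fin 3) (Fin 3) E)) (ts : List (ℤ × Finset (Matrix (Fin 3) (Fin 3) E)))
    (G : (Fin 2 → ℂ) → (Fin 2 → ℂ)) :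
    d.heckeSum ⟨t :: ts⟩ G = (t.1 • fun w => ∑ r ∈ t.2, pullField (d.act r) G w) + d.heckeSum ⟨ts⟩ G := by
  funext z
  rw [d.heckeSum_cons]
  rfl

/-- The pull-back of an integer multiple. -/
theorem pullField_zsmul (φ : (Fin 2 → ℂ) → (Fin 2 → ℂ)) (n : ℤ) (G : (Fin 2 → ℂ) → (Fin 2 → ℂ)) (z : Fin 2 → ℂ) :
    pullField φ (n • G) z = n • pullField φ G z := by
  simp only [pullField, Pi.smul_apply, Matrix.mulVec_smul]

/-- **The Hecke sum is `Γ′`-invariant on the ball** for a Hecke element of level `Γ′`. -/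
theorem pullField_act_heckeSum {Γ' : Set (Matrix (Fin 3) (Fin 3) E)} (hΓ' : IsCongruenceSubgroup (conjE E) d.H Γ')
    (ts : List (ℤ × Finset (Matrix (Fin 3) (Fin 3) E))) (hh : HeckeElement.IsFor (conjE E) d.H Γ' ⟨ts⟩)
    {G : (Fin 2 → ℂ) → (Fin 2 → ℂ)} (hG : d.IsAutForm1 Γ' G) {δ : Matrix (Fin 3) (Fin 3) E} (hδ : δ ∈ Γ')
    {z : Fin 2 → ℂ} (hz : z ∈ ball) :
    pullField (d.act δ) (d.heckeSum ⟨ts⟩ G) z = d.heckeSum ⟨ts⟩ G z := by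
  induction ts with
  | nil =>
    simp [heckeSum, pullField]
  | cons t ts ih =>
    have hh' : HeckeElement.IsFor (conjE E) d.H Γ' ⟨ts⟩ := fun t' ht' => hh t' (List.mem_cons_of_mem _ ht')
    rw [d.heckeSum_cons_fun, pullField_add, Pi.add_apply, pullField_zsmul, ih hh', d.pullField_act_finset_sum]
    obtain ⟨g, hg, hR⟩ := hh t List.mem_cons_self
    rw [d.pullField_act_sum_reps hΓ' hg hR hG hδ hz]
    simp only [Pi.add_apply, Pi.smul_apply]

/-- **The Hecke translate of a `1`-form of `X_{Γ′}` by a Hecke element of level `Γ′` is a `1`-form of `X_{Γ′}`.** -/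
theorem heckeField_isAutForm1 {Γ' : Set (Matrix (Fin 3) (Fin 3) E)} (hΓ' : IsCongruenceSubgroup (conjE E) d.H Γ')
    {h : HeckeElement E} (hh : h.IsFor (conjE E) d.H Γ') {G : (Fin 2 → ℂ) → (Fin 2 → ℂ)}
    (hG : d.IsAutForm1 Γ' G) : d.IsAutForm1 Γ' (d.heckeField h G) := by
  refine ⟨fun z hz => d.heckeField_of_not_mem h G hz, fun δ hδ z hz => ?_⟩
  have hδu : IsUnitaryOf (conjE E) d.H δ := hΓ'.isUnitaryOf hδ
  have hzδ : d.act δ z ∈ ball := d.act_mem_ball_of_unitary hδu hz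
  rw [d.heckeField_of_mem h G hz]
  have hpull : pullField (d.act δ) (d.heckeField h G) z = pullField (d.act δ) (d.heckeSum h G) z := by
    simp only [pullField]
    rw [d.heckeField_of_mem h G hzδ]
  rw [hpull]
  obtain ⟨ts⟩ := h
  exact d.pullField_act_heckeSum hΓ' ts hh hG hδ hz

/-- The Hecke translate of a form of `X_{Γ′}` lies in `autForms1 Γ′`. -/
theorem heckeField_mem_autForms1 {Γ' : Set (Matrix (Fin 3) (Fin 3) E)} (hΓ' : IsCongruenceSubgroup (conjE E) d.H Γ')
    {h : HeckeElement E} (hh : h.IsFor (conjE E) d.H Γ') {G : (Fin 2 → ℂ) → (Fin 2 → ℂ)}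
    (hG : G ∈ d.autForms1 Γ') : d.heckeField h G ∈ d.autForms1 Γ' :=
  d.heckeField_isAutForm1 hΓ' hh hG

end TargetData

end Summit.Ventures.HodgeRepro.Tier4
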